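import Summits.QuantumFields.BalabanUV.Beta.CombBorderReflectionLetters
import Summits.QuantumFields.BalabanUV.Beta.CombSecondOrderRemainderAn1
import Summits.QuantumFields.BalabanUV.Beta.WilsonLetterColourFree
import Summits.QuantumFields.BalabanUV.Beta.WilsonReflectionContact
import Summits.QuantumFields.BalabanUV.Beta.ReflectionLocusSymShift

/-!
# `BalabanUV.Beta.CombLevelZeroT2Law` — binder row D1, chart (III′), programme P5, brick P5-0b: **THE LEVEL-0 SECOND-ORDER TABLE OF THE (III′) LITERAL
# IS AXIS-REFLECTION COVARIANT EXACTLY — ZERO REMAINDER — HENCE THE LEVEL-0 T2-REMAINDER `combR2An1 … 0` OF THE REPAIR TRACK VANISHES IDENTICALLY**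

WHAT.  `T2_0 = cE₂ • wilsonW₂ 3 ((8N²)⁻¹ • wsym22 N) + cB • symVh₂SAn1 3 Lc` (`SpineRooted.T2RecOf` member `0`; `cE₂ = Lc⁸`, `cB = −Lc¹²∕4`), the level-0 legged
border `𝕄_0 = bhKStepSh 3 Lc (Dsh Lc) 0 = bhK Lc + Dsh Lc`, the level-0 pure jet `S_0 = SpureRecOf … 0 = cE • wilsonA + cVH • symVhSAt ρ_c` and the E3 generator
`γ_0·ctGenM 3 (bhK Lc + Dsh Lc)` with the displayed `γ_j` (`γ_0 = −Lc⁴∕2`).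
* §1 the level-0 entries in the level-`j+1` SHAPE (`wB2 0 = stepScale 0 = 1`, `ReflectionLocusSymShift.wVH_zero`; `SpureRecOf_zero_inl_inr`… = `(cVH·wVH 0)·symVhSAt` on the border blocks, the
  Wilson cubic living on `ff` — `WilsonReflectionContact.wilsonA_inl_inr`…; `bhKStepSh_zero_…` = `stepScale 0·(bhK + D)`; `bhKStepSh_Dsh_zero_inl_inl` = `bhKAt`'s `ff`).
* §2 **(W-0B) AT LEVEL 0**: `hBfm_comb_zero`, `hBmf_comb_zero`, `hBmm_comb_zero` — the three second-order BORDER table reflection letters of an1's `symVh₂SAn1`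
  against `𝕄_0`, `S_0`, the E3 generator, remainder `0`: the PROOFS of gen-36's `CombBorderReflectionLetters.hBfm_comb`∕`hBmf_comb`∕`hBmm_comb` (an1-g43's
  `SymRootedBorderTableLaw.symBondLaw` + entry bookkeeping) with `j + 1 ↦ 0` through §1 — the level-`j+1` files never stated the level-0 instance because
  ROOT J′'s (hT2-rem) induction took its base `h0` with the remainder DEFINED as the full defect (`CombSecondOrderRemainderAn1.h0_comb`).
* §3 **(W-0W) AT LEVEL 0 IN THE LITERAL's CURRENCY**: `hWff_comb_zero` (`2 ≤ N`) — an3-g32's colour-free canonical Wilson law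
  `WilsonLetterColourFree.wilsonW₂_bref_ff_canon_bhKAt_su` (table `(8N²)⁻¹ • wsym22 N`, `κ₁ = −½`, canonical second symbol, `R₀ = 0`) scaled by `cE₂ = cE²` and
  re-lettered to `𝕄_0`, `S_0`, `γ_0·ctGenM (bhK + Dsh)` (on `ff` the conjW word sees only `𝕄`'s `ff` block, `S_0`'s `ff` block `cE·wilsonA`, and the FIELD legs of
  the generators, which `ctGen` and `ctGenM (bhK + Dsh)` share).
* §4 **`T2RecOf_zero_bref_comb`**: `T2_0 (κ, bref α κ u, κ′, bref α κ′ u′) = (ε_κ ε_κ′) • refK (Φ Lc α) (T2_0 κ u κ′ u′ + conjW 𝕄_0 (S_0 κ u) (S_0 κ′ u′) (γ_0 D_κu) (γ_0 D_κ′u′)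
  (γ_0² D_κu D_κ′u′))` — EXACT, by fibre blocks (`ff` §3, the border table has no `ff` block; `fm`∕`mf`∕`mm` §2, the Wilson bi-stencil has no border block); the
  pattern of an2-g19's `SecondOrderZeroCanon.quarticZero_bref_of_ffLaw` in the `ctGenM (bhK + Dsh)` currency.
* §5 **`combR2An1_zero_eq_zero`**: `combR2An1 Lc N cΛ γ X2s 0 α κ u κ′ u′ = 0` (every `N ≥ 2`, `cΛ`, `X2s`; `Lc` odd; `γ` with `hγ`) — member `0` of P6-8's
  `combR2An1` IS `(εε′) • refK (T2_0 (bref, bref)) − T2_0 − (that conjW word)`, which §4 and the involution `refK ∘ refK = id` make zero.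
CONSEQUENCE (with P5-a `CombRemainderTadpoleSlot`, separate file): ROOT M″'s scalar `hRm0` HOLDS AT LEVEL `j = 0` as a kernel theorem — `tadpole (GcombSh Lc 0) (Rm_0 α μ y ν y′)
= ½·(tadpole G′_0 (vertex2OfK G′_0 Lc (combR2An1 … 0 α) …) + swap) = 0`; the assembled statement is filed in a third file once both have landed.  Engine C's (E0) table
(R-D1-HRM0-E0, `ttrl/requests.jsonl` l.2727∕l.2763) at the literal (4,3), LEVEL 0, is thereby PREDICTED ≡ 0 by the kernel; a nonzero entry there would be a
transcription finding, not a finding about `hRm0`.  The OPEN content of `hRm0` is now the levels `j ≥ 1` (the transport `hR2succ_comb`).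

HONEST FRAMING (cell contract, verbatim): «discharging `BetaPertH` makes Bałaban's UV stability UNCONDITIONAL — a real constructive-QFT
result; it is NOT the continuum limit and NOT the Clay problem.»  HONEST DEPENDENCY: continuum YM on T⁴ ⇐ BetaPertH ∧ nine spine estimates (0/9 proved);
BetaPertH ⇐ (D1) ∧ (D4) ∧ CAP+tail; G-an2-4 gates asym, D1 and NE2/3/4.
DERIVED cell leaf ([folklore] kernel algebra over OUR typed objects BY NAME; β sub-cell, BINDER-OWNERS row D1 OWNER `b2b-balaban-beta-an2` gen 38).  No statement
of Bałaban's papers, no `[cite:]`, no `Prop` fact, no `def`.  HONEST: a LEVEL-0 identity among OUR transcribed tables (an1's `symVh₂SAn1`∕`symVhSAt`, an3's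
`wsym22`, an2's borders and generators); NO binder of the row is discharged by this file (row-D1 binders 0∕4, repair-track classes 0∕4; `hRm0` for `j ≥ 1` OPEN);
the ROOT OF RECORD is the referee's to name; NOT D1, NOT `BetaPertH`, NOT continuum, NOT Clay.
Provenance: β sub-cell, unit beta-an2 gen 38, 2026-08-22 (v1); over `CombBorderReflectionLetters` (gen 36), `CombSecondOrderRemainderAn1` (gen 36∕37),
`WilsonLetterColourFree` ∕ `WilsonReflectionContact(2)` (an3 g32), `SymRootedBorderTableLaw` (an1 g43), `SymBorderReflectionLetters` (gen 32) BY NAME; no existing file touched.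
-/

noncomputable section

open Finset
open scoped BigOperators
open Literature.Probability.LatticeModels (Torus.proj)
open Literature.MathematicalPhysics.QuantumFieldTheory
open Literature.MathematicalPhysics.QuantumFieldTheory.Balaban1983to89
open Literature.MathematicalPhysics.QuantumFieldTheory.Balaban1983to89.Beta
open ExpKernelCalculus (MKer comp)
open PolarizationSign (reflSign)
open KernelReflection (refK refK_apply)
open ResolventReflection (bref Φ Φ_r_inl Φ_r_inr Φ_s_inl Φ_s_inr bref_bref reflSign_mul_self mref)
open RootedKernelReflection (off_mref_eq_zero_iff blk_mref)
open AffineAveraging (box toSite)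
open AveragingContours (blk off)
open AveragingContoursRooted (ctr ctrOff ctrOff_mem_box)
open AveragingHessianKernels (Bond packVH packVH_inl_inr packVH_inr_inl packVH_inl_inl packVH_inr_inr)
open LatticeForm (quo)
open OneStepResolventKernel (Fib)
open OneStepKernelFamily (KInvStep)
open StepJetData (wilsonA)
open BalabanStepJetsSucc (wE wVH)
open BalabanStepW2 (wB2 wV4 M2Of)
open WilsonBiStencil (wilsonW₂ wilsonW₂_inl_inr wilsonW₂_inr_inl wilsonW₂_inr_inr)
open WilsonVertex2Sym (wsym22)
open Summit.QuantumFields.BalabanUV.Beta.TameKernelCalculus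
open Summit.QuantumFields.BalabanUV.Beta.ChartConjugation (conjV conjW conjW₁ conjW₂)
open Summit.QuantumFields.BalabanUV.Beta.AxialDressingRooted (one_le_of_neZero)
open Summit.QuantumFields.BalabanUV.Beta.CombChartStepJets (GcombSh)
open Summit.QuantumFields.BalabanUV.Beta.SpineRooted (SpureRecOf SpureRecOf_zero_level M1Of T2RecOf T2RecOf_zero_level e3OfK)
open Summit.QuantumFields.BalabanUV.Beta.SymShiftedSpread (bhKStepSh bhKStepSh_apply bhKStepSh_zero)
open Summit.QuantumFields.BalabanUV.Beta.BorderedHessian (bhK bhK_inl_inl bhK_inr_inr bhKAt bhKAt_inl_inl bhKStep stepScale diagK diagK_apply comp_diagK_left comp_diagK_right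
  off_eq_zero_iff_proj blk_eq_quo ctGen ctGen_inl)
open Summit.QuantumFields.BalabanUV.Beta.E3ContactGenerator (ctGenM ctGenM_inl ctGenM_inr)
open Summit.QuantumFields.BalabanUV.Beta.DshAn1 (Dsh Dsh_inr_inr Dsh_inl_inl)
open Summit.QuantumFields.BalabanUV.Beta.SymAveragingHessianCounts (symVhSAt symVhKerAt symLinKerAt symHessFFAt symVhSAt_inl_inl)
open Summit.QuantumFields.BalabanUV.Beta.SymAveragingMixedJetTables (symVh2KerAt symMixFFAt)
open Summit.QuantumFields.BalabanUV.Beta.SymSecondOrderTablesAn1 (symVh₂SAn1 symVh₂SAn1_inl_inl symVh₂SAn1_inr_inr symVh₂SAn1_antiTwin)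
open Summit.QuantumFields.BalabanUV.Beta.SymWardLettersUnpacking (symVhSAt_inl_inr' symVh₂SAn1_inl_inr)
open Summit.QuantumFields.BalabanUV.Beta.SymVhSliceReflectionAn1 (symB_inl_inr symB_inr_inl symB_inr_inr)
open Summit.QuantumFields.BalabanUV.Beta.SymRootedBorderTableLaw (symBondLaw)
open Summit.QuantumFields.BalabanUV.Beta.FP.SliceBiContactChart (conjW_diagK_apply)
open Summit.QuantumFields.BalabanUV.Beta.SecondOrderStepLaw (conjW_diag_apply)
open Summit.QuantumFields.BalabanUV.Beta.SymBorderReflectionLetters (ctGenM_inl_F ctGenM_inr_Q ctGenM_inr_off symVhSAt_inr_inl' symVhSAt_inr_inr' wVH_eq_sq wB2_eq_cube gamma_eq)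
open Summit.QuantumFields.BalabanUV.Beta.WilsonReflectionContact (wilsonA_inl_inr wilsonA_inr_inl wilsonA_inr_inr)
open Summit.QuantumFields.BalabanUV.Beta.WilsonLetterColourFree (wilsonW₂_bref_ff_canon_bhKAt_su)
open Summit.QuantumFields.BalabanUV.Beta.CombSecondOrderRemainderAn1 (combR2An1)
open Summit.QuantumFields.BalabanUV.Beta.ReflectionLocusSymShift (wVH_zero)
open Summit.QuantumFields.BalabanUV.Beta.E3LevelOneReflection (refK_smul refK_add refK_Φ_refK_Φ)

namespace Summit.QuantumFields.BalabanUV.Beta.CombLevelZeroT2Law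

variable {Lc : ℕ} [NeZero Lc]

/-! ## §1 Level-0 entries: the border blocks of the pure jet `S_0` and of the legged border `𝕄_0`, in the level-`j+1` shape -/

section Entries

variable {d : ℕ} {V H : Fin (d + 1) → (Fin (d + 1) → ℤ) → MKer (d + 1) (Fib d)} {G : ℕ → MKer (d + 1) (Fib d)} {cE cVH cΛ : ℝ}

omit [NeZero Lc] in
/-- [folklore] `stepScale d Lc 0 = 1`. -/
theorem stepScale_zero : stepScale d Lc 0 = 1 := by simp [BorderedHessian.stepScale]

omit [NeZero Lc] in
/-- [folklore] `wB2 d Lc 0 = 1`. -/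
theorem wB2_zero : wB2 d Lc 0 = 1 := by simp [BalabanStepW2.wB2]

/-- [folklore] Field–multiplier block of the level-0 pure jet: `(cVH·wVH 0) • V` (the Wilson cubic lives on the field–field block). -/
theorem SpureRecOf_zero_inl_inr (κ : Fin (d + 1)) (u x z : Fin (d + 1) → ℤ) (β m : Fin (d + 1)) :
    SpureRecOf d Lc V H G cE cVH cΛ 0 κ u x z (Sum.inl β) (Sum.inr m) = (cVH * wVH d Lc 0) * V κ u x z (Sum.inl β) (Sum.inr m) := by
  simp only [SpureRecOf_zero_level, Pi.add_apply, Pi.smul_apply, smul_eq_mul, wilsonA_inl_inr, mul_zero, zero_add, wVH_zero, mul_one]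

/-- [folklore] Multiplier–field block of the level-0 pure jet. -/
theorem SpureRecOf_zero_inr_inl (κ : Fin (d + 1)) (u x z : Fin (d + 1) → ℤ) (m β : Fin (d + 1)) :
    SpureRecOf d Lc V H G cE cVH cΛ 0 κ u x z (Sum.inr m) (Sum.inl β) = (cVH * wVH d Lc 0) * V κ u x z (Sum.inr m) (Sum.inl β) := by
  simp only [SpureRecOf_zero_level, Pi.add_apply, Pi.smul_apply, smul_eq_mul, wilsonA_inr_inl, mul_zero, zero_add, wVH_zero, mul_one]

/-- [folklore] Multiplier–multiplier block of the level-0 pure jet. -/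
theorem SpureRecOf_zero_inr_inr (κ : Fin (d + 1)) (u x z : Fin (d + 1) → ℤ) (m m' : Fin (d + 1)) :
    SpureRecOf d Lc V H G cE cVH cΛ 0 κ u x z (Sum.inr m) (Sum.inr m') = (cVH * wVH d Lc 0) * V κ u x z (Sum.inr m) (Sum.inr m') := by
  simp only [SpureRecOf_zero_level, Pi.add_apply, Pi.smul_apply, smul_eq_mul, wilsonA_inr_inr, mul_zero, zero_add, wVH_zero, mul_one]

/-- [folklore] The level-0 legged border on the field–multiplier block, in the level-`j+1` shape: `stepScale 0·(bhK + D)`. -/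
theorem bhKStepSh_zero_inl_inr (D : MKer (d + 1) (Fib d)) (x z : Fin (d + 1) → ℤ) (β m : Fin (d + 1)) :
    bhKStepSh d Lc D 0 x z (Sum.inl β) (Sum.inr m) = stepScale d Lc 0 * (bhK Lc + D : MKer (d + 1) (Fib d)) x z (Sum.inl β) (Sum.inr m) := by
  rw [bhKStepSh_zero, stepScale_zero, one_mul]

/-- [folklore] The same on the multiplier–field block. -/
theorem bhKStepSh_zero_inr_inl (D : MKer (d + 1) (Fib d)) (x z : Fin (d + 1) → ℤ) (m β : Fin (d + 1)) :
    bhKStepSh d Lc D 0 x z (Sum.inr m) (Sum.inl β) = stepScale d Lc 0 * (bhK Lc + D : MKer (d + 1) (Fib d)) x z (Sum.inr m) (Sum.inl β) := by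
  rw [bhKStepSh_zero, stepScale_zero, one_mul]

/-- [folklore] The same on the multiplier–multiplier block (`bhK` vanishes there). -/
theorem bhKStepSh_zero_inr_inr (D : MKer (d + 1) (Fib d)) (x z : Fin (d + 1) → ℤ) (m m' : Fin (d + 1)) :
    bhKStepSh d Lc D 0 x z (Sum.inr m) (Sum.inr m') = stepScale d Lc 0 * D x z (Sum.inr m) (Sum.inr m') := by
  rw [bhKStepSh_zero, stepScale_zero, one_mul, Pi.add_apply, Pi.add_apply, Pi.add_apply, Pi.add_apply, bhK_inr_inr, zero_add]

/-- [folklore] Field–field block of the level-0 legged border `bhK Lc + Dsh Lc`: the (window-free) `d*d` entry of `bhKAt`. -/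
theorem bhKStepSh_Dsh_zero_inl_inl (x z : Fin (d + 1) → ℤ) (a b : Fin (d + 1)) :
    bhKStepSh d Lc (Dsh Lc) 0 x z (Sum.inl a) (Sum.inl b) = bhKAt d (ctr (d + 1) Lc) Lc x z (Sum.inl a) (Sum.inl b) := by
  rw [bhKStepSh_zero, Pi.add_apply, Pi.add_apply, Pi.add_apply, Pi.add_apply, Dsh_inl_inl, add_zero, bhKAt_inl_inl, bhK_inl_inl]

end Entries

/-! ## §2 (W-0B) AT LEVEL 0: the three second-order border table reflection letters of the (III′)∕sym literal, level `0`, ZERO remainder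
(the proofs of `CombBorderReflectionLetters.hBfm_comb`∕`hBmf_comb`∕`hBmm_comb` with the level-0 entries of §1; `wB2 0 = wVH 0 = stepScale 0 = 1`, `γ_0 = −Lc⁴∕2`) -/

/-- [folklore] **THE BORDER LETTER (field–multiplier legs) AT LEVEL 0 — A THEOREM**, `RBr := 0`. -/
theorem hBfm_comb_zero (hLc : Odd Lc) (cΛ : ℝ) (γ : ℕ → ℝ)
    (hγ : ∀ j, γ j = -((Lc : ℝ) ^ 8 / 2) * wVH 3 Lc j / (stepScale 3 Lc j * (Lc : ℝ) ^ 4)) :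
    ∀ (α : Fin 4) (κ : Fin 4) (u : Fin 4 → ℤ) (κ' : Fin 4) (u' : Fin 4 → ℤ) (x z : Fin 4 → ℤ) (β m : Fin 4),
      (((-((Lc : ℝ) ^ 12 / 4)) * wB2 3 Lc 0) • symVh₂SAn1 3 Lc κ (bref α κ u) κ' (bref α κ' u')) x z (Sum.inl β) (Sum.inr m) =
        ((reflSign α κ * reflSign α κ') • refK (Φ Lc α) (((-((Lc : ℝ) ^ 12 / 4)) * wB2 3 Lc 0) • symVh₂SAn1 3 Lc κ u κ' u' +
          conjW (bhKStepSh 3 Lc (Dsh Lc) 0)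
            (SpureRecOf 3 Lc (symVhSAt (ctr 4 Lc) 3 Lc rfl) (symHessFFAt (ctr 4 Lc) Lc) (GcombSh Lc) ((Lc : ℝ) ^ 4) (-((Lc : ℝ) ^ 8 / 2)) cΛ 0 κ u)
            (SpureRecOf 3 Lc (symVhSAt (ctr 4 Lc) 3 Lc rfl) (symHessFFAt (ctr 4 Lc) Lc) (GcombSh Lc) ((Lc : ℝ) ^ 4) (-((Lc : ℝ) ^ 8 / 2)) cΛ 0 κ' u')
            (diagK fun p c => γ 0 * ctGenM 3 (bhK Lc + Dsh Lc) α Lc κ u p c) (diagK fun p c => γ 0 * ctGenM 3 (bhK Lc + Dsh Lc) α Lc κ' u' p c)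
            (diagK fun p c => (γ 0 * ctGenM 3 (bhK Lc + Dsh Lc) α Lc κ u p c) * (γ 0 * ctGenM 3 (bhK Lc + Dsh Lc) α Lc κ' u' p c)) +
          (0 : ℕ → Fin 4 → Fin 4 → (Fin 4 → ℤ) → Fin 4 → (Fin 4 → ℤ) → MKer 4 (Fib 3)) 0 α κ u κ' u')) x z (Sum.inl β) (Sum.inr m) := by
  classical
  intro α κ u κ' u' x z β m
  have hLc1 : 1 ≤ Lc := one_le_of_neZero Lc
  have hγ' := gamma_eq γ hγ 0
  have e4 : ctr (3 + 1) Lc = ctr 4 Lc := rfl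
  -- unfold the kernel words to entries
  simp only [Pi.smul_apply, Pi.add_apply, Pi.zero_apply, smul_eq_mul, add_zero, refK_apply, Φ_s_inl, Φ_s_inr, Φ_r_inl, Φ_r_inr,
    conjW_diagK_apply, SpureRecOf_zero_inl_inr, bhKStepSh_zero_inl_inr, symVh₂SAn1_inl_inr, symVhSAt_inl_inr', symB_inl_inr,
    ctGenM_inl_F, e4, ← blk_eq_quo]
  by_cases hz : off Lc z = 0
  · have hz' : off Lc (mref Lc α m z) = 0 := (off_mref_eq_zero_iff hLc1 α m z).2 hz
    have hzp : Torus.proj Lc (mref Lc α m z) = 0 := (off_eq_zero_iff_proj _).1 hz'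
    have hblk : blk Lc (mref Lc α m z) = bref α m (blk Lc z) := blk_mref hLc1 α m hz
    simp only [hz, hz', hzp, if_true, ctGenM_inr_Q _ _ _ _ _ hzp, hblk]
    have hB := symBondLaw hLc α m (bref α m (blk Lc z)) β (bref α β x) κ u κ' u'
    simp only [bref_bref] at hB
    have hE : (reflSign α β * reflSign α κ * reflSign α κ' * reflSign α m) * (reflSign α β * reflSign α κ * reflSign α κ' * reflSign α m) = 1 := by
      have h1 := reflSign_mul_self α β; have h2 := reflSign_mul_self α κ; have h3 := reflSign_mul_self α κ'; have h4 := reflSign_mul_self α m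
      calc (reflSign α β * reflSign α κ * reflSign α κ' * reflSign α m) * (reflSign α β * reflSign α κ * reflSign α κ' * reflSign α m)
          = (reflSign α β * reflSign α β) * (reflSign α κ * reflSign α κ) * (reflSign α κ' * reflSign α κ') * (reflSign α m * reflSign α m) := by ring
        _ = 1 := by rw [h1, h2, h3, h4]; ring
    have eL : ((Lc : ℝ) ^ (3 + 1)) = (Lc : ℝ) ^ 4 := by norm_num
    rw [hγ', wB2_eq_cube, wVH_eq_sq, eL]
    set P1 := symVh2KerAt (ctr 4 Lc) Lc m (blk Lc z) (β, x) (κ, bref α κ u) (κ', bref α κ' u') with hP1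
    set P2 := symVh2KerAt (ctr 4 Lc) Lc m (blk Lc z) (β, x) (κ', bref α κ' u') (κ, bref α κ u) with hP2
    set R1 := symVh2KerAt (ctr 4 Lc) Lc m (bref α m (blk Lc z)) (β, bref α β x) (κ, u) (κ', u') with hR1
    set R2 := symVh2KerAt (ctr 4 Lc) Lc m (bref α m (blk Lc z)) (β, bref α β x) (κ', u') (κ, u) with hR2
    set Mg := symVhKerAt (ctr 4 Lc) Lc m (bref α m (blk Lc z)) (β, bref α β x) (κ, u) with hMg
    set Mh := symVhKerAt (ctr 4 Lc) Lc m (bref α m (blk Lc z)) (β, bref α β x) (κ', u') with hMh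
    set Qf := symLinKerAt (ctr 4 Lc) Lc m (bref α m (blk Lc z)) (β, bref α β x) with hQf
    set Qg := (if m = α then symLinKerAt (ctr 4 Lc) Lc m (bref α m (blk Lc z)) (κ, u) else 0) with hQg
    set Qh := (if m = α then symLinKerAt (ctr 4 Lc) Lc m (bref α m (blk Lc z)) (κ', u') else 0) with hQh
    set Fg := (if bref α β x = u ∧ β = κ ∧ κ = α then (1 : ℝ) else 0) with hFg
    set Fh := (if bref α β x = u' ∧ β = κ' ∧ κ' = α then (1 : ℝ) else 0) with hFh
    set σ := stepScale 3 Lc 0 with hσ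
    set E := reflSign α β * reflSign α κ * reflSign α κ' * reflSign α m with hEdef
    linear_combination (1 / 2 * E * (-((Lc : ℝ) ^ 12 / 4) * σ ^ 3)) * hB - (1 / 2 * (-((Lc : ℝ) ^ 12 / 4) * σ ^ 3) * (P1 + P2)) * hE
  · have hz' : ¬ off Lc (mref Lc α m z) = 0 := fun h => hz ((off_mref_eq_zero_iff hLc1 α m z).1 h)
    have hzp : ¬ Torus.proj Lc (mref Lc α m z) = 0 := fun h => hz' ((off_eq_zero_iff_proj _).2 h)
    simp only [hz, hz', hzp, if_false, mul_zero, zero_mul, add_zero]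

/-- [folklore] **THE BINDER `hBmf` OF THE LITERAL ROOT (multiplier–field legs) — A THEOREM** (same data; the anti-twin of `hBfm_comb`: the block leg now
sits at `x`, the fluctuation leg at `z`). -/
theorem hBmf_comb_zero (hLc : Odd Lc) (cΛ : ℝ) (γ : ℕ → ℝ)
    (hγ : ∀ j, γ j = -((Lc : ℝ) ^ 8 / 2) * wVH 3 Lc j / (stepScale 3 Lc j * (Lc : ℝ) ^ 4)) :
    ∀ (α : Fin 4) (κ : Fin 4) (u : Fin 4 → ℤ) (κ' : Fin 4) (u' : Fin 4 → ℤ) (x z : Fin 4 → ℤ) (m β : Fin 4),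
      (((-((Lc : ℝ) ^ 12 / 4)) * wB2 3 Lc 0) • symVh₂SAn1 3 Lc κ (bref α κ u) κ' (bref α κ' u')) x z (Sum.inr m) (Sum.inl β) =
        ((reflSign α κ * reflSign α κ') • refK (Φ Lc α) (((-((Lc : ℝ) ^ 12 / 4)) * wB2 3 Lc 0) • symVh₂SAn1 3 Lc κ u κ' u' +
          conjW (bhKStepSh 3 Lc (Dsh Lc) 0)
            (SpureRecOf 3 Lc (symVhSAt (ctr 4 Lc) 3 Lc rfl) (symHessFFAt (ctr 4 Lc) Lc) (GcombSh Lc) ((Lc : ℝ) ^ 4) (-((Lc : ℝ) ^ 8 / 2)) cΛ 0 κ u)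
            (SpureRecOf 3 Lc (symVhSAt (ctr 4 Lc) 3 Lc rfl) (symHessFFAt (ctr 4 Lc) Lc) (GcombSh Lc) ((Lc : ℝ) ^ 4) (-((Lc : ℝ) ^ 8 / 2)) cΛ 0 κ' u')
            (diagK fun p c => γ 0 * ctGenM 3 (bhK Lc + Dsh Lc) α Lc κ u p c) (diagK fun p c => γ 0 * ctGenM 3 (bhK Lc + Dsh Lc) α Lc κ' u' p c)
            (diagK fun p c => (γ 0 * ctGenM 3 (bhK Lc + Dsh Lc) α Lc κ u p c) * (γ 0 * ctGenM 3 (bhK Lc + Dsh Lc) α Lc κ' u' p c)) +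
          (0 : ℕ → Fin 4 → Fin 4 → (Fin 4 → ℤ) → Fin 4 → (Fin 4 → ℤ) → MKer 4 (Fib 3)) 0 α κ u κ' u')) x z (Sum.inr m) (Sum.inl β) := by
  classical
  intro α κ u κ' u' x z m β
  have hLc1 : 1 ≤ Lc := one_le_of_neZero Lc
  have hγ' := gamma_eq γ hγ 0
  have e4 : ctr (3 + 1) Lc = ctr 4 Lc := rfl
  simp only [Pi.smul_apply, Pi.add_apply, Pi.zero_apply, smul_eq_mul, add_zero, refK_apply, Φ_s_inl, Φ_s_inr, Φ_r_inl, Φ_r_inr,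
    conjW_diagK_apply, SpureRecOf_zero_inr_inl, bhKStepSh_zero_inr_inl, symVh₂SAn1_antiTwin, symVh₂SAn1_inl_inr,
    symVhSAt_inr_inl', symB_inr_inl, ctGenM_inl_F, e4, ← blk_eq_quo]
  by_cases hx : off Lc x = 0
  · have hx' : off Lc (mref Lc α m x) = 0 := (off_mref_eq_zero_iff hLc1 α m x).2 hx
    have hxp : Torus.proj Lc (mref Lc α m x) = 0 := (off_eq_zero_iff_proj _).1 hx'
    have hblk : blk Lc (mref Lc α m x) = bref α m (blk Lc x) := blk_mref hLc1 α m hx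
    simp only [hx, hx', hxp, if_true, ctGenM_inr_Q _ _ _ _ _ hxp, hblk]
    have hB := symBondLaw hLc α m (bref α m (blk Lc x)) β (bref α β z) κ u κ' u'
    simp only [bref_bref] at hB
    have hE : (reflSign α β * reflSign α κ * reflSign α κ' * reflSign α m) * (reflSign α β * reflSign α κ * reflSign α κ' * reflSign α m) = 1 := by
      have h1 := reflSign_mul_self α β; have h2 := reflSign_mul_self α κ; have h3 := reflSign_mul_self α κ'; have h4 := reflSign_mul_self α m
      calc (reflSign α β * reflSign α κ * reflSign α κ' * reflSign α m) * (reflSign α β * reflSign α κ * reflSign α κ' * reflSign α m)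
          = (reflSign α β * reflSign α β) * (reflSign α κ * reflSign α κ) * (reflSign α κ' * reflSign α κ') * (reflSign α m * reflSign α m) := by ring
        _ = 1 := by rw [h1, h2, h3, h4]; ring
    have eL : ((Lc : ℝ) ^ (3 + 1)) = (Lc : ℝ) ^ 4 := by norm_num
    rw [hγ', wB2_eq_cube, wVH_eq_sq, eL]
    set P1 := symVh2KerAt (ctr 4 Lc) Lc m (blk Lc x) (β, z) (κ, bref α κ u) (κ', bref α κ' u') with hP1
    set P2 := symVh2KerAt (ctr 4 Lc) Lc m (blk Lc x) (β, z) (κ', bref α κ' u') (κ, bref α κ u) with hP2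
    set R1 := symVh2KerAt (ctr 4 Lc) Lc m (bref α m (blk Lc x)) (β, bref α β z) (κ, u) (κ', u') with hR1
    set R2 := symVh2KerAt (ctr 4 Lc) Lc m (bref α m (blk Lc x)) (β, bref α β z) (κ', u') (κ, u) with hR2
    set Mg := symVhKerAt (ctr 4 Lc) Lc m (bref α m (blk Lc x)) (β, bref α β z) (κ, u) with hMg
    set Mh := symVhKerAt (ctr 4 Lc) Lc m (bref α m (blk Lc x)) (β, bref α β z) (κ', u') with hMh
    set Qf := symLinKerAt (ctr 4 Lc) Lc m (bref α m (blk Lc x)) (β, bref α β z) with hQf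
    set Qg := (if m = α then symLinKerAt (ctr 4 Lc) Lc m (bref α m (blk Lc x)) (κ, u) else 0) with hQg
    set Qh := (if m = α then symLinKerAt (ctr 4 Lc) Lc m (bref α m (blk Lc x)) (κ', u') else 0) with hQh
    set Fg := (if bref α β z = u ∧ β = κ ∧ κ = α then (1 : ℝ) else 0) with hFg
    set Fh := (if bref α β z = u' ∧ β = κ' ∧ κ' = α then (1 : ℝ) else 0) with hFh
    set σ := stepScale 3 Lc 0 with hσ
    set E := reflSign α β * reflSign α κ * reflSign α κ' * reflSign α m with hEdef
    linear_combination (-(1 / 2 * E * (-((Lc : ℝ) ^ 12 / 4) * σ ^ 3))) * hB + (1 / 2 * (-((Lc : ℝ) ^ 12 / 4) * σ ^ 3) * (P1 + P2)) * hE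
  · have hx' : ¬ off Lc (mref Lc α m x) = 0 := fun h => hx ((off_mref_eq_zero_iff hLc1 α m x).1 h)
    have hxp : ¬ Torus.proj Lc (mref Lc α m x) = 0 := fun h => hx' ((off_eq_zero_iff_proj _).2 h)
    simp only [hx, hx', hxp, if_false, mul_zero, zero_mul, add_zero, neg_zero]

/-- [folklore] **THE BINDER `hBmm` OF THE LITERAL ROOT (two multiplier legs) — A THEOREM**: both sides vanish (`symVh₂SAn1` and `symVhSAt` have no
multiplier–multiplier block; `bhKStepSh 0` is `stepScale 0·Dsh` there, and `Dsh` vanishes there). -/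
theorem hBmm_comb_zero (cΛ : ℝ) (γ : ℕ → ℝ) :
    ∀ (α : Fin 4) (κ : Fin 4) (u : Fin 4 → ℤ) (κ' : Fin 4) (u' : Fin 4 → ℤ) (x z : Fin 4 → ℤ) (m m' : Fin 4),
      (((-((Lc : ℝ) ^ 12 / 4)) * wB2 3 Lc 0) • symVh₂SAn1 3 Lc κ (bref α κ u) κ' (bref α κ' u')) x z (Sum.inr m) (Sum.inr m') =
        ((reflSign α κ * reflSign α κ') • refK (Φ Lc α) (((-((Lc : ℝ) ^ 12 / 4)) * wB2 3 Lc 0) • symVh₂SAn1 3 Lc κ u κ' u' +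
          conjW (bhKStepSh 3 Lc (Dsh Lc) 0)
            (SpureRecOf 3 Lc (symVhSAt (ctr 4 Lc) 3 Lc rfl) (symHessFFAt (ctr 4 Lc) Lc) (GcombSh Lc) ((Lc : ℝ) ^ 4) (-((Lc : ℝ) ^ 8 / 2)) cΛ 0 κ u)
            (SpureRecOf 3 Lc (symVhSAt (ctr 4 Lc) 3 Lc rfl) (symHessFFAt (ctr 4 Lc) Lc) (GcombSh Lc) ((Lc : ℝ) ^ 4) (-((Lc : ℝ) ^ 8 / 2)) cΛ 0 κ' u')
            (diagK fun p c => γ 0 * ctGenM 3 (bhK Lc + Dsh Lc) α Lc κ u p c) (diagK fun p c => γ 0 * ctGenM 3 (bhK Lc + Dsh Lc) α Lc κ' u' p c)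
            (diagK fun p c => (γ 0 * ctGenM 3 (bhK Lc + Dsh Lc) α Lc κ u p c) * (γ 0 * ctGenM 3 (bhK Lc + Dsh Lc) α Lc κ' u' p c)) +
          (0 : ℕ → Fin 4 → Fin 4 → (Fin 4 → ℤ) → Fin 4 → (Fin 4 → ℤ) → MKer 4 (Fib 3)) 0 α κ u κ' u')) x z (Sum.inr m) (Sum.inr m') := by
  intro α κ u κ' u' x z m m'
  simp only [Pi.smul_apply, Pi.add_apply, Pi.zero_apply, smul_eq_mul, add_zero, refK_apply, Φ_s_inr, Φ_r_inr,
    conjW_diagK_apply, SpureRecOf_zero_inr_inr, bhKStepSh_zero_inr_inr, symVh₂SAn1_inr_inr, symVhSAt_inr_inr', Dsh_inr_inr,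
    mul_zero, zero_mul, add_zero]


/-! ## §3 (W-0W) AT LEVEL 0 IN THE LITERAL's CURRENCY: the Wilson `ff` law against `𝕄_0`, `S_0`, `γ_0·ctGenM (bhK + Dsh)` -/

/-- [folklore] Field–field entry of the level-0 pure jet: `cE·wilsonA` (an1's border table vanishes there). -/
theorem SpureRecOf_zero_inl_inl {d : ℕ} {H : Fin (d + 1) → (Fin (d + 1) → ℤ) → MKer (d + 1) (Fib d)} {G : ℕ → MKer (d + 1) (Fib d)}
    (ρ : Fin (d + 1) → ℤ) (cE cVH cΛ : ℝ) (κ : Fin (d + 1)) (u x z : Fin (d + 1) → ℤ) (β β' : Fin (d + 1)) :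
    SpureRecOf d Lc (symVhSAt ρ d Lc rfl) H G cE cVH cΛ 0 κ u x z (Sum.inl β) (Sum.inl β') = cE * wilsonA d κ u x z (Sum.inl β) (Sum.inl β') := by
  simp only [SpureRecOf_zero_level, Pi.add_apply, Pi.smul_apply, smul_eq_mul, symVhSAt_inl_inl, mul_zero, add_zero]

/-- [folklore] **THE WILSON `ff` LAW AT LEVEL 0 IN THE (III′)∕sym LITERAL's CURRENCY** (`2 ≤ N`): an3-g32's colour-free canonical law
`WilsonLetterColourFree.wilsonW₂_bref_ff_canon_bhKAt_su` (table `(8N²)⁻¹ • wsym22 N`, `κ₁ = −½`, canonical second symbol, `R₀ = 0`), scaled by `cE₂ = Lc⁸`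
and re-lettered: on the field–field block the conjW word sees only `𝕄`'s `ff` block (`bhK + Dsh` there = `bhKAt`'s), the `ff` block of `S_0` (`= cE·wilsonA`) and the
FIELD legs of the generators (`ctGenM (bhK + Dsh)`'s = `ctGen`'s), and `γ_0 = cE·(−½) = −Lc⁴∕2`, `cE₂ = cE²`. -/
theorem hWff_comb_zero {N : ℕ} (hN : 2 ≤ N) (cΛ : ℝ) (γ : ℕ → ℝ)
    (hγ : ∀ j, γ j = -((Lc : ℝ) ^ 8 / 2) * wVH 3 Lc j / (stepScale 3 Lc j * (Lc : ℝ) ^ 4)) :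
    ∀ (α : Fin 4) (κ : Fin 4) (u : Fin 4 → ℤ) (κ' : Fin 4) (u' : Fin 4 → ℤ) (x z : Fin 4 → ℤ) (β β' : Fin 4),
      (((Lc : ℝ) ^ 8) • wilsonW₂ 3 ((8 * (N : ℝ) ^ 2)⁻¹ • wsym22 N) κ (bref α κ u) κ' (bref α κ' u')) x z (Sum.inl β) (Sum.inl β') =
        ((reflSign α κ * reflSign α κ') • refK (Φ Lc α) (((Lc : ℝ) ^ 8) • wilsonW₂ 3 ((8 * (N : ℝ) ^ 2)⁻¹ • wsym22 N) κ u κ' u' +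
          conjW (bhKStepSh 3 Lc (Dsh Lc) 0)
            (SpureRecOf 3 Lc (symVhSAt (ctr 4 Lc) 3 Lc rfl) (symHessFFAt (ctr 4 Lc) Lc) (GcombSh Lc) ((Lc : ℝ) ^ 4) (-((Lc : ℝ) ^ 8 / 2)) cΛ 0 κ u)
            (SpureRecOf 3 Lc (symVhSAt (ctr 4 Lc) 3 Lc rfl) (symHessFFAt (ctr 4 Lc) Lc) (GcombSh Lc) ((Lc : ℝ) ^ 4) (-((Lc : ℝ) ^ 8 / 2)) cΛ 0 κ' u')
            (diagK fun p c => γ 0 * ctGenM 3 (bhK Lc + Dsh Lc) α Lc κ u p c) (diagK fun p c => γ 0 * ctGenM 3 (bhK Lc + Dsh Lc) α Lc κ' u' p c)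
            (diagK fun p c => (γ 0 * ctGenM 3 (bhK Lc + Dsh Lc) α Lc κ u p c) * (γ 0 * ctGenM 3 (bhK Lc + Dsh Lc) α Lc κ' u' p c)))) x z (Sum.inl β) (Sum.inl β') := by
  classical
  intro α κ u κ' u' x z β β'
  have h := wilsonW₂_bref_ff_canon_bhKAt_su (d := 3) hN (ctr 4 Lc) Lc Lc α κ κ' u u' x z β β'
  have hγ0 : γ 0 = -((Lc : ℝ) ^ 4 / 2) := by rw [gamma_eq γ hγ 0, stepScale_zero, mul_one]
  simp only [Pi.smul_apply, Pi.add_apply, smul_eq_mul, refK_apply, Φ_s_inl, Φ_r_inl, conjW_diag_apply, SpureRecOf_zero_inl_inl,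
    bhKStepSh_Dsh_zero_inl_inl, ctGenM_inl, ctGen_inl, hγ0] at h ⊢
  linear_combination ((Lc : ℝ) ^ 8) * h

/-! ## §4 THE EXACT LEVEL-0 SECOND-ORDER REFLECTION LAW OF `T2_0` (zero remainder), assembled by fibre blocks -/

/-- [folklore] **THE LEVEL-0 SECOND-ORDER TABLE OF THE (III′) LITERAL IS AXIS-REFLECTION COVARIANT EXACTLY, IN `conjW` FORM WITH THE LITERAL's OWN
LEVEL-0 CONTACT WORD, ZERO REMAINDER** (`Lc` odd, `2 ≤ N`, `γ` with the displayed `hγ`): `ff` by §3 (the border table has no `ff` block), `fm`∕`mf`∕`mm`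
by §2 (the Wilson bi-stencil has no border block) — the pattern of an2-g19's `SecondOrderZeroCanon.quarticZero_bref_of_ffLaw` in the `ctGenM (bhK + Dsh)` currency. -/
theorem T2RecOf_zero_bref_comb (hLc : Odd Lc) {N : ℕ} (hN : 2 ≤ N) (cΛ : ℝ) (γ : ℕ → ℝ)
    (hγ : ∀ j, γ j = -((Lc : ℝ) ^ 8 / 2) * wVH 3 Lc j / (stepScale 3 Lc j * (Lc : ℝ) ^ 4)) :
    ∀ (α κ : Fin 4) (u : Fin 4 → ℤ) (κ' : Fin 4) (u' : Fin 4 → ℤ),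
      T2RecOf 3 Lc (GcombSh Lc) (SpureRecOf 3 Lc (symVhSAt (ctr 4 Lc) 3 Lc rfl) (symHessFFAt (ctr 4 Lc) Lc) (GcombSh Lc) ((Lc : ℝ) ^ 4) (-((Lc : ℝ) ^ 8 / 2)) cΛ)
          (M1Of 3 Lc (symHessFFAt (ctr 4 Lc) Lc) cΛ) ((Lc : ℝ) ^ 8) (-((Lc : ℝ) ^ 12 / 4)) ((8 * (N : ℝ) ^ 2)⁻¹ • wsym22 N) (symVh₂SAn1 3 Lc) (symMixFFAt (ctr 4 Lc) Lc)
          0 κ (bref α κ u) κ' (bref α κ' u') =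
        (reflSign α κ * reflSign α κ') • refK (Φ Lc α)
          (T2RecOf 3 Lc (GcombSh Lc) (SpureRecOf 3 Lc (symVhSAt (ctr 4 Lc) 3 Lc rfl) (symHessFFAt (ctr 4 Lc) Lc) (GcombSh Lc) ((Lc : ℝ) ^ 4) (-((Lc : ℝ) ^ 8 / 2)) cΛ)
              (M1Of 3 Lc (symHessFFAt (ctr 4 Lc) Lc) cΛ) ((Lc : ℝ) ^ 8) (-((Lc : ℝ) ^ 12 / 4)) ((8 * (N : ℝ) ^ 2)⁻¹ • wsym22 N) (symVh₂SAn1 3 Lc) (symMixFFAt (ctr 4 Lc) Lc)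
              0 κ u κ' u' +
            conjW (bhKStepSh 3 Lc (Dsh Lc) 0)
              (SpureRecOf 3 Lc (symVhSAt (ctr 4 Lc) 3 Lc rfl) (symHessFFAt (ctr 4 Lc) Lc) (GcombSh Lc) ((Lc : ℝ) ^ 4) (-((Lc : ℝ) ^ 8 / 2)) cΛ 0 κ u)
              (SpureRecOf 3 Lc (symVhSAt (ctr 4 Lc) 3 Lc rfl) (symHessFFAt (ctr 4 Lc) Lc) (GcombSh Lc) ((Lc : ℝ) ^ 4) (-((Lc : ℝ) ^ 8 / 2)) cΛ 0 κ' u')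
              (diagK fun p c => γ 0 * ctGenM 3 (bhK Lc + Dsh Lc) α Lc κ u p c) (diagK fun p c => γ 0 * ctGenM 3 (bhK Lc + Dsh Lc) α Lc κ' u' p c)
              (diagK fun p c => (γ 0 * ctGenM 3 (bhK Lc + Dsh Lc) α Lc κ u p c) * (γ 0 * ctGenM 3 (bhK Lc + Dsh Lc) α Lc κ' u' p c))) := by
  intro α κ u κ' u'
  funext x z a b
  simp only [T2RecOf_zero_level]
  rcases a with β | m <;> rcases b with β' | m'
  · have hW := hWff_comb_zero (Lc := Lc) hN cΛ γ hγ α κ u κ' u' x z β β'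
    simp only [Pi.add_apply, Pi.smul_apply, smul_eq_mul, refK_apply, Φ_s_inl, Φ_r_inl, symVh₂SAn1_inl_inl, mul_zero, add_zero] at hW ⊢
    linear_combination hW
  · have hB := hBfm_comb_zero (Lc := Lc) hLc cΛ γ hγ α κ u κ' u' x z β m'
    simp only [Pi.add_apply, Pi.smul_apply, Pi.zero_apply, smul_eq_mul, add_zero, refK_apply, Φ_s_inl, Φ_s_inr, Φ_r_inl, Φ_r_inr,
      wilsonW₂_inl_inr, wB2_zero, mul_one, mul_zero, zero_add] at hB ⊢
    linear_combination hB
  · have hB := hBmf_comb_zero (Lc := Lc) hLc cΛ γ hγ α κ u κ' u' x z m β'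
    simp only [Pi.add_apply, Pi.smul_apply, Pi.zero_apply, smul_eq_mul, add_zero, refK_apply, Φ_s_inl, Φ_s_inr, Φ_r_inl, Φ_r_inr,
      wilsonW₂_inr_inl, wB2_zero, mul_one, mul_zero, zero_add] at hB ⊢
    linear_combination hB
  · have hB := hBmm_comb_zero (Lc := Lc) cΛ γ α κ u κ' u' x z m m'
    simp only [Pi.add_apply, Pi.smul_apply, Pi.zero_apply, smul_eq_mul, add_zero, refK_apply, Φ_s_inr, Φ_r_inr,
      wilsonW₂_inr_inr, wB2_zero, mul_one, mul_zero, zero_add] at hB ⊢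
    linear_combination hB

/-! ## §5 HENCE THE LEVEL-0 T2-REMAINDER OF THE (III′) REPAIR TRACK VANISHES IDENTICALLY -/

/-- [folklore] **`combR2An1 … 0 = 0`** (every `N ≥ 2`, `cΛ`, `X2s`; `γ` with the displayed `hγ`; `Lc` odd): the level-0 remainder of ROOT J′'s (hT2-rem) is DEFINED
as the α-reflection defect of `T2_0` minus the literal's contact word (`CombSecondOrderRemainderAn1.combR2An1`, member `0`); by §4 that defect IS the
contact word, so the remainder is zero (`refK ∘ refK = id`, `(ε_κ ε_κ′)² = 1`). -/
theorem combR2An1_zero_eq_zero (hLc : Odd Lc) {N : ℕ} (hN : 2 ≤ N) (cΛ : ℝ) (γ : ℕ → ℝ)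
    (hγ : ∀ j, γ j = -((Lc : ℝ) ^ 8 / 2) * wVH 3 Lc j / (stepScale 3 Lc j * (Lc : ℝ) ^ 4))
    (X2s : ℕ → Fin 4 → Fin 4 → (Fin 4 → ℤ) → Fin 4 → (Fin 4 → ℤ) → (Fin 4 → ℤ) → Fib 3 → ℝ)
    (α κ : Fin 4) (u : Fin 4 → ℤ) (κ' : Fin 4) (u' : Fin 4 → ℤ) :
    combR2An1 Lc N cΛ γ X2s 0 α κ u κ' u' = 0 := by
  have hT := T2RecOf_zero_bref_comb (Lc := Lc) hLc hN cΛ γ hγ α κ u κ' u'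
  have he : (reflSign α κ * reflSign α κ') * (reflSign α κ * reflSign α κ') = 1 := by
    rw [show (reflSign α κ * reflSign α κ') * (reflSign α κ * reflSign α κ') = (reflSign α κ * reflSign α κ) * (reflSign α κ' * reflSign α κ') by ring,
      reflSign_mul_self, reflSign_mul_self, one_mul]
  simp only [combR2An1]
  rw [hT, refK_smul, refK_Φ_refK_Φ, smul_smul, he, one_smul]
  abel

end Summit.QuantumFields.BalabanUV.Beta.CombLevelZeroT2Law

end
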